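import Mathlib
import HarnessLib
import Summits.NavierStokesRegularity.NavierStokesRegularity.Theorems.TypeILiouvilleGeneralizedBeltrami
import Summits.NavierStokesRegularity.NavierStokesRegularity.Theorems.TypeILiouvilleShorelineAnalytic

/-!
# TypeILiouvilleGeneralizedBeltramiLocal — crux (L) stmt-NavierStokesRegularity-10661 `TypeIliouvilleL`:
# LOCALLY GENERALIZED BELTRAMI ANYWHERE IN SPACE–TIME ⟹ TRIVIAL

Helper for stmt-NavierStokesRegularity-10661 (`--supports`); theorems only, no definitions, no named-fact hypotheses;
closes no item; Navier–Stokes regularity is NOT proved here (leafhand seat of the EulerZoomLiouville route; sequel to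
`TypeILiouvilleGeneralizedBeltrami`, whose global theorem `classP_const_of_convect_comm` is the engine).

Class P = print's class of bounded ancient mild solutions (KNSS 2009 §4 (i)).  The VORTEX COMMUTATOR of a class-P flow,
`𝔠(t,x) = Dv(t)(x)[curl v(t)(x)] − D(curl v(t))(x)[v(t)(x)] = curl (v × ω)(t,x)`, is a JOINTLY REAL-ANALYTIC function
on the open past slab `(−∞,0) × ℝ³` (joint analyticity of class P, `classP_analyticOnNhd_uncurry`, Lemarié-Rieusset 2016
Thm 9.12; derivatives and bilinear evaluations of analytic maps).  Hence:

* §1 `classP_analyticOnNhd_convectComm` — joint analyticity of `𝔠`.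
* §2 ★ `classP_const_of_spacetimeLocally_convect_comm` — **if `𝔠` vanishes on ONE nonempty open SPACE–TIME set, the
  flow is one constant vector** (identity theorem on the connected slab + `classP_const_of_convect_comm`);
  `classP_const_of_spacetimeLocally_lambCurlFree` (Lamb-vector form), `classP_const_of_spacetimeLocally_parallel`
  (vorticity parallel to velocity on an open space–time set ⟹ trivial).
* §3 `classP_convectComm_ne_zero_of_nonconst` — contrapositive: **in a NON-CONSTANT member of class P the vortex
  commutator `curl (v × ω)` is non-zero on a DENSE subset of space–time** (every nonempty open space–time set carries a
  point where stretching and advection of vorticity do not balance).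

HONEST LABEL: a classical sector and its localisation; nothing here proves a registered stub, (L), or Navier–Stokes
regularity; rung 0. [cite: LemarieRieusset2016, Thm. 9.12 (PDF p. 260)]
[cite: KochNadirashviliSereginSverak2009, §4 (i), Remark 6.1 (arXiv:0709.3599)] [cite: MajdaBertozziCUP2002, §1.1, §2.3]
-/

noncomputable section
open MeasureTheory Filter Set Function Metric
open scoped Topology ENNReal RealInnerProductSpace Laplacian ContDiff
open Literature.Analysis Literature.Analysis.FluidPDE Literature.Analysis.UnboundedOperators
open Summit.NavierStokesRegularity.NavierStokesRegularity.Theorems.TypeILiouvilleShoreline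
set_option linter.dupNamespace false
namespace Summit.NavierStokesRegularity.NavierStokesRegularity.Theorems.TypeILiouvilleGeneralizedBeltrami

/-! ## §1 The vortex commutator is jointly real-analytic -/

/-- The spatial derivative of a slice is the partial derivative of the uncurried field:
`D(v t)(x) = D(uncurry v)(t,x) ∘ inr` wherever `uncurry v` is differentiable. [folklore] -/
theorem fderiv_slice_eq_comp_inr
    {v : ℝ → EuclideanSpace ℝ (Fin 3) → EuclideanSpace ℝ (Fin 3)} {t : ℝ} {x : EuclideanSpace ℝ (Fin 3)}
    (h : DifferentiableAt ℝ (uncurry v) (t, x)) :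
    fderiv ℝ (v t) x = (fderiv ℝ (uncurry v) (t, x)).comp (ContinuousLinearMap.inr ℝ ℝ (EuclideanSpace ℝ (Fin 3))) := by
  have hc : HasFDerivAt (uncurry v ∘ fun y => (t, y))
      ((fderiv ℝ (uncurry v) (t, x)).comp (ContinuousLinearMap.inr ℝ ℝ (EuclideanSpace ℝ (Fin 3)))) x :=
    h.hasFDerivAt.comp x (hasFDerivAt_prodMk_right t x)
  exact hc.fderiv

/-- **The vortex commutator `(t,x) ↦ Dv(t)(x)[curl v(t)(x)] − D(curl v(t))(x)[v(t)(x)]` of a class-P flow is jointly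
real-analytic on `(−∞,0) × ℝ³`.** [cite: LemarieRieusset2016, Thm. 9.12 (PDF p. 260)] -/
theorem classP_analyticOnNhd_convectComm
    {v : ℝ → EuclideanSpace ℝ (Fin 3) → EuclideanSpace ℝ (Fin 3)}
    (hc : ContinuousOn (uncurry v) (Iio 0 ×ˢ univ))
    (hK : ∃ K : ℝ, ∀ t < 0, ∀ x, ‖v t x‖ ≤ K)
    (hm : ∀ s t : ℝ, s < t → t < 0 → ∀ x,
      v t x = heatExtension (v s) (t - s) x - oseenDuhamel 1 s v v t x) :
    AnalyticOnNhd ℝ (fun p : ℝ × EuclideanSpace ℝ (Fin 3) =>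
      fderiv ℝ (v p.1) p.2 (curl (v p.1) p.2) - fderiv ℝ (curl (v p.1)) p.2 (v p.1 p.2))
      (Iio (0 : ℝ) ×ˢ (univ : Set (EuclideanSpace ℝ (Fin 3)))) := by
  set S : Set (ℝ × EuclideanSpace ℝ (Fin 3)) := Iio (0 : ℝ) ×ˢ univ with hS
  have hO : IsOpen S := isOpen_Iio.prod isOpen_univ
  have hf : AnalyticOnNhd ℝ (uncurry v) S := classP_analyticOnNhd_uncurry hc hK hm
  have hDf : AnalyticOnNhd ℝ (fderiv ℝ (uncurry v)) S := hf.fderiv_of_isOpen hO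
  set inr3 : EuclideanSpace ℝ (Fin 3) →L[ℝ] ℝ × EuclideanSpace ℝ (Fin 3) :=
    ContinuousLinearMap.inr ℝ ℝ (EuclideanSpace ℝ (Fin 3)) with hinr3
  set cL := ContinuousLinearMap.compL ℝ (EuclideanSpace ℝ (Fin 3)) (ℝ × EuclideanSpace ℝ (Fin 3))
    (EuclideanSpace ℝ (Fin 3)) with hcL
  -- the slice gradient `p ↦ D(uncurry v)(p) ∘ inr` is analytic
  have hG : AnalyticOnNhd ℝ (fun p => (fderiv ℝ (uncurry v) p).comp inr3) S := by
    intro p hp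
    have h := (cL.analyticAt_bilinear (fderiv ℝ (uncurry v) p, inr3)).comp₂ (hDf p hp) analyticAt_const
    simpa only [hcL, ContinuousLinearMap.compL_apply] using h
  -- the uncurried vorticity is analytic: near every point of `S` it is `curlCLM (D(uncurry v) ∘ inr)`
  have hΩ : AnalyticOnNhd ℝ (uncurry (vorticity v)) S := by
    intro p hp
    have h1 : AnalyticAt ℝ (fun q => curlCLM ((fderiv ℝ (uncurry v) q).comp inr3)) p :=
      (curlCLM.comp_analyticOnNhd hG) p hp
    refine h1.congr ?_
    filter_upwards [hO.mem_nhds hp] with q hq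
    obtain ⟨t, x⟩ := q
    show curlCLM ((fderiv ℝ (uncurry v) (t, x)).comp inr3) = vorticity v t x
    rw [vorticity_apply, curl_eq_curlCLM, fderiv_slice_eq_comp_inr (hf _ hq).differentiableAt]
  have hDΩ : AnalyticOnNhd ℝ (fderiv ℝ (uncurry (vorticity v))) S := hΩ.fderiv_of_isOpen hO
  -- bilinear evaluations
  set ev := ContinuousLinearMap.id ℝ (ℝ × EuclideanSpace ℝ (Fin 3) →L[ℝ] EuclideanSpace ℝ (Fin 3)) with hev
  have hι1 : AnalyticOnNhd ℝ (fun p => ((0 : ℝ), uncurry (vorticity v) p)) S := fun p hp =>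
    analyticAt_const.prod (hΩ p hp)
  have hι2 : AnalyticOnNhd ℝ (fun p => ((0 : ℝ), uncurry v p)) S := fun p hp =>
    analyticAt_const.prod (hf p hp)
  have hF : AnalyticOnNhd ℝ (fun p => fderiv ℝ (uncurry v) p ((0 : ℝ), uncurry (vorticity v) p) -
      fderiv ℝ (uncurry (vorticity v)) p ((0 : ℝ), uncurry v p)) S := by
    intro p hp
    have h1 : AnalyticAt ℝ (fun p => fderiv ℝ (uncurry v) p ((0 : ℝ), uncurry (vorticity v) p)) p :=
      (ev.analyticAt_bilinear (fderiv ℝ (uncurry v) p, ((0 : ℝ), uncurry (vorticity v) p))).comp₂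
        (hDf p hp) (hι1 p hp)
    have h2 : AnalyticAt ℝ (fun p => fderiv ℝ (uncurry (vorticity v)) p ((0 : ℝ), uncurry v p)) p :=
      (ev.analyticAt_bilinear (fderiv ℝ (uncurry (vorticity v)) p, ((0 : ℝ), uncurry v p))).comp₂
        (hDΩ p hp) (hι2 p hp)
    exact h1.sub h2
  -- the slice form agrees with the uncurried form on the open slab
  intro p hp
  refine (hF p hp).congr ?_
  filter_upwards [hO.mem_nhds hp] with q hq
  obtain ⟨t, x⟩ := q
  have hdf : DifferentiableAt ℝ (uncurry v) (t, x) := (hf _ hq).differentiableAt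
  have hdΩ : DifferentiableAt ℝ (uncurry (vorticity v)) (t, x) := (hΩ _ hq).differentiableAt
  rw [Carleman.fderiv_apply_zero_eq_fderiv_slice hdf, Carleman.fderiv_apply_zero_eq_fderiv_slice hdΩ]
  simp only [uncurry_apply_pair, vorticity_apply]

/-! ## §2 ★ One space–time patch of balance forces a constant flow -/

/-- ★ **LOCALLY GENERALIZED BELTRAMI ANYWHERE IN SPACE–TIME ⟹ ONE CONSTANT VECTOR.**  If the vortex commutator
`Dv(t)(x)[curl v(t)(x)] − D(curl v(t))(x)[v(t)(x)]` of a class-P flow vanishes on ONE nonempty open subset of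
`(−∞,0) × ℝ³`, it vanishes identically (identity theorem for the jointly analytic commutator on the connected slab), and
the flow is one constant vector (`classP_const_of_convect_comm`).
[cite: LemarieRieusset2016, Thm. 9.12; KochNadirashviliSereginSverak2009, §4 (i), Remark 6.1 (arXiv:0709.3599)] -/
theorem classP_const_of_spacetimeLocally_convect_comm
    {v : ℝ → EuclideanSpace ℝ (Fin 3) → EuclideanSpace ℝ (Fin 3)}
    (hc : ContinuousOn (uncurry v) (Iio 0 ×ˢ univ))
    (hK : ∃ K : ℝ, ∀ t < 0, ∀ x, ‖v t x‖ ≤ K)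
    (hd : ∀ t < 0, IsWeaklyDivFree (v t))
    (hm : ∀ s t : ℝ, s < t → t < 0 → ∀ x,
      v t x = heatExtension (v s) (t - s) x - oseenDuhamel 1 s v v t x)
    {W : Set (ℝ × EuclideanSpace ℝ (Fin 3))} (hWo : IsOpen W) (hWne : W.Nonempty)
    (hWS : W ⊆ Iio (0 : ℝ) ×ˢ univ)
    (h : ∀ p ∈ W, fderiv ℝ (v p.1) p.2 (curl (v p.1) p.2) = fderiv ℝ (curl (v p.1)) p.2 (v p.1 p.2)) :
    ∃ b : EuclideanSpace ℝ (Fin 3), ∀ t < 0, ∀ x, v t x = b := by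
  have hpre : IsPreconnected (Iio (0 : ℝ) ×ˢ (univ : Set (EuclideanSpace ℝ (Fin 3)))) :=
    ((convex_Iio (0 : ℝ)).prod convex_univ).isPreconnected
  obtain ⟨p₀, hp₀⟩ := hWne
  have hev : (fun p : ℝ × EuclideanSpace ℝ (Fin 3) =>
      fderiv ℝ (v p.1) p.2 (curl (v p.1) p.2) - fderiv ℝ (curl (v p.1)) p.2 (v p.1 p.2)) =ᶠ[𝓝 p₀] 0 :=
    Filter.eventually_of_mem (hWo.mem_nhds hp₀) fun q hq => by
      simp only [Pi.zero_apply, h q hq, sub_self]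
  have hzero := (classP_analyticOnNhd_convectComm hc hK hm).eqOn_zero_of_preconnected_of_eventuallyEq_zero hpre
    (hWS hp₀) hev
  refine classP_const_of_convect_comm hc hK hd hm fun t ht x => ?_
  have := hzero (show ((t, x) : ℝ × EuclideanSpace ℝ (Fin 3)) ∈ Iio (0 : ℝ) ×ˢ (univ : Set (EuclideanSpace ℝ (Fin 3)))
    from mem_prod.2 ⟨mem_Iio.2 ht, mem_univ x⟩)
  exact sub_eq_zero.1 this

/-- **Lamb-vector form**: if `curl (v(t) × curl v(t))(x) = 0` for all `(t,x)` in ONE nonempty open space–time set, the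
class-P flow is one constant vector. [cite: LemarieRieusset2016, Thm. 9.12; MajdaBertozziCUP2002, §1.1] -/
theorem classP_const_of_spacetimeLocally_lambCurlFree
    {v : ℝ → EuclideanSpace ℝ (Fin 3) → EuclideanSpace ℝ (Fin 3)}
    (hc : ContinuousOn (uncurry v) (Iio 0 ×ˢ univ))
    (hK : ∃ K : ℝ, ∀ t < 0, ∀ x, ‖v t x‖ ≤ K)
    (hd : ∀ t < 0, IsWeaklyDivFree (v t))
    (hm : ∀ s t : ℝ, s < t → t < 0 → ∀ x,
      v t x = heatExtension (v s) (t - s) x - oseenDuhamel 1 s v v t x)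
    {W : Set (ℝ × EuclideanSpace ℝ (Fin 3))} (hWo : IsOpen W) (hWne : W.Nonempty)
    (hWS : W ⊆ Iio (0 : ℝ) ×ˢ univ)
    (h : ∀ p ∈ W, curl (fun y => cross (v p.1 y) (curl (v p.1) y)) p.2 = 0) :
    ∃ b : EuclideanSpace ℝ (Fin 3), ∀ t < 0, ∀ x, v t x = b := by
  obtain ⟨K, hKb⟩ := hK
  obtain ⟨hsm', -⟩ := smooth_and_bounds_of_bounded_ancient_oseenMild hc hd hm hKb
  have hsm : IsSmoothSpaceTimeOn (Iio 0) v := hsm'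
  have hslice : ∀ t < 0, ContDiff ℝ 2 (v t) := fun t ht =>
    (hsm.contDiff_slice (mem_Iio.2 ht)).of_le (by norm_cast)
  have hdiv' : ∀ t < 0, VectorCalculus.IsDivFree (v t) := fun t ht =>
    (hd t ht).isDivFree_of_contDiff ((hslice t ht).of_le (by norm_num))
  refine classP_const_of_spacetimeLocally_convect_comm hc ⟨K, hKb⟩ hd hm hWo hWne hWS fun p hp => ?_
  have ht : p.1 < 0 := (mem_prod.1 (hWS hp)).1
  have key := curl_lamb_eq_sub (hslice p.1 ht) (hdiv' p.1 ht) p.2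
  rw [h p hp] at key
  exact (sub_eq_zero.1 key.symm)

/-- **Vorticity parallel to velocity on ONE nonempty open space–time set ⟹ one constant vector** (the Lamb vector
vanishes on the open set, so its curl vanishes there). [cite: MajdaBertozziCUP2002, §2.3 (Beltrami flows); LemarieRieusset2016, Thm. 9.12] -/
theorem classP_const_of_spacetimeLocally_parallel
    {v : ℝ → EuclideanSpace ℝ (Fin 3) → EuclideanSpace ℝ (Fin 3)}
    (hc : ContinuousOn (uncurry v) (Iio 0 ×ˢ univ))
    (hK : ∃ K : ℝ, ∀ t < 0, ∀ x, ‖v t x‖ ≤ K)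
    (hd : ∀ t < 0, IsWeaklyDivFree (v t))
    (hm : ∀ s t : ℝ, s < t → t < 0 → ∀ x,
      v t x = heatExtension (v s) (t - s) x - oseenDuhamel 1 s v v t x)
    {W : Set (ℝ × EuclideanSpace ℝ (Fin 3))} (hWo : IsOpen W) (hWne : W.Nonempty)
    (hWS : W ⊆ Iio (0 : ℝ) ×ˢ univ)
    (h : ∀ p ∈ W, cross (v p.1 p.2) (curl (v p.1) p.2) = 0) :
    ∃ b : EuclideanSpace ℝ (Fin 3), ∀ t < 0, ∀ x, v t x = b := by
  refine classP_const_of_spacetimeLocally_lambCurlFree hc hK hd hm hWo hWne hWS fun p hp => ?_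
  obtain ⟨t, x⟩ := p
  -- the Lamb vector of the slice `t` vanishes near `x`
  have hsec : IsOpen {y : EuclideanSpace ℝ (Fin 3) | (t, y) ∈ W} :=
    hWo.preimage (Continuous.prodMk_right t)
  have hev : (fun y => cross (v t y) (curl (v t) y)) =ᶠ[𝓝 x] fun _ => 0 :=
    Filter.eventually_of_mem (hsec.mem_nhds hp) fun y hy => h (t, y) hy
  show curl (fun y => cross (v t y) (curl (v t) y)) x = 0
  rw [curl_eq_curlCLM, hev.fderiv_eq, fderiv_const_apply, map_zero]

/-! ## §3 Contrapositive: the commutator of a non-constant member is non-zero densely -/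

/-- **In a NON-CONSTANT class-P flow the vortex commutator is non-zero on a dense subset of space–time**: every nonempty
open subset of `(−∞,0) × ℝ³` contains a point where `Dv(t)(x)[curl v(t)(x)] ≠ D(curl v(t))(x)[v(t)(x)]`, i.e. where
`curl (v × ω) ≠ 0`. [cite: LemarieRieusset2016, Thm. 9.12; KochNadirashviliSereginSverak2009, §4 (i) (arXiv:0709.3599)] -/
theorem classP_convectComm_ne_zero_of_nonconst
    {v : ℝ → EuclideanSpace ℝ (Fin 3) → EuclideanSpace ℝ (Fin 3)}
    (hc : ContinuousOn (uncurry v) (Iio 0 ×ˢ univ))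
    (hK : ∃ K : ℝ, ∀ t < 0, ∀ x, ‖v t x‖ ≤ K)
    (hd : ∀ t < 0, IsWeaklyDivFree (v t))
    (hm : ∀ s t : ℝ, s < t → t < 0 → ∀ x,
      v t x = heatExtension (v s) (t - s) x - oseenDuhamel 1 s v v t x)
    (hnc : ¬ ∃ b : EuclideanSpace ℝ (Fin 3), ∀ t < 0, ∀ x, v t x = b)
    {W : Set (ℝ × EuclideanSpace ℝ (Fin 3))} (hWo : IsOpen W) (hWne : W.Nonempty)
    (hWS : W ⊆ Iio (0 : ℝ) ×ˢ univ) :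
    ∃ p ∈ W, fderiv ℝ (v p.1) p.2 (curl (v p.1) p.2) ≠ fderiv ℝ (curl (v p.1)) p.2 (v p.1 p.2) := by
  by_contra hcon
  push Not at hcon
  exact hnc (classP_const_of_spacetimeLocally_convect_comm hc hK hd hm hWo hWne hWS hcon)

end Summit.NavierStokesRegularity.NavierStokesRegularity.Theorems.TypeILiouvilleGeneralizedBeltrami

end
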